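import Summits.CriticalPhenomena.PercolationContinuityZ3.Theorems.PercNearOneGluingNoHeavyLowerTailSahiOneStepProfileGridAndOr
import Summits.CriticalPhenomena.PercolationContinuityZ3.Theorems.PercNearOneGluingNoHeavyLowerTailSahiOneStepProfileGridOrStep
import HarnessLib

/-!
# THEOREM G45-B: `(2′)` on a product of `PF₂` chains against every CATERPILLAR READ-ONCE FORMULA of coordinate thresholds

Prover prim-ineq-prove-3 gen 46 (`--supports stmt-CriticalPhenomena-4575`; memo
`run/shared/lean/prim/prim-ineq-prove-3/PROOF-G45-CHAIN-RULE.md` §6).  Assembly of the CHAIN RULE (`gridK_step`,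
`…ProfileGridAndOr`, gen 45) and the OR-CYLINDER STEP (`gridK_orStep`, `…ProfileGridOrStep`, gen 45).

Call an event `B` of the grid `κ → {0,…,N}` a **universal `(2′)`-partner** if, for EVERY family of `PF₂` weights `φ_j`
(not normalised), EVERY slot `t` and EVERY numerator `u` with `0 ≤ u ≤ Φ = Π φ_j` and the one-coordinate cross inequalities
(`u = a·Φ`, `a` a monotone density), the homogeneous one-step functional of `…ProfileGridChainRule` is nonnegative:
`K̃(Φ, u; B) = Z·ℓ·⟨u 1_{H∩B}⟩ + Z·⟨u 1_L⟩·⟨Φ 1_{B∩L}⟩ − ℓ·⟨u⟩·⟨Φ 1_B⟩ ≥ 0` (`H = {Σ_j v_j ≥ t}`, `L = Hᶜ`, `Z = ⟨Φ⟩`,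
`ℓ = ⟨Φ 1_L⟩`).  This property is WRITTEN OUT in every statement (no definitions in this file).
* `gridK_univ_threshold` — a single threshold `{c ≤ v_i}` is universal (gen 44, `gridK_or_nonneg`); `gridK_univ_true`.
* `gridK_univ_andStep` — if `B` is universal and increasing then so is `{c ≤ v_i} ∩ B` (the chain rule; conditioning on the
  cylinder keeps the `PF₂` class, `IsLogConcaveSeq.truncGE`).
* `gridK_univ_orStep` — if `B` is universal and does not depend on `v_i` then `{c ≤ v_i} ∪ B` is universal (the OR-step; its
  hypotheses are the universality of `B` on the low piece `φ_i·1_{<c}` and on the point pieces `φ_i·1_{=y}` at shifted slots,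
  both again `PF₂` weights).
* `gridK_caterpillar_nonneg` — by induction along a list of nodes `(i, c, tag)` (`tag = true`: AND-node `{c ≤ v_i} ∩ ·`,
  `tag = false`: OR-node `{c ≤ v_i} ∪ ·`, innermost event `True`), every right-nested ("caterpillar") read-once formula
  `U₁ ∘₁ (U₂ ∘₂ (⋯ ∘ U_k))`, `∘ ∈ {∧, ∨}`, `U_m = {c_m ≤ v_{i_m}}`, whose OR-nodes use a coordinate not occurring further inside, is a
  universal `(2′)`-partner: **THEOREM G45-B** (contains gen 44's OR of thresholds, gen 45's box ∩ OR, gen 26's literal caterpillars).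
* `grid_osN_caterpillar_nonneg` — the normalised five-term shape of `osN_ind_ind`, consumed by the cube file `…SahiOneStepCaterpillar`.
No definitions, no sorries.
-/

noncomputable section

namespace Summit.CriticalPhenomena.PercolationContinuityZ3.Theorems

namespace SahiOneStep

namespace ProfileGrid

open Finset Function
open Literature.Probability.Distributions (IsLogConcaveSeq piWeight blockSum)
open scoped Classical

variable {κ : Type*} [Fintype κ] [DecidableEq κ] {N : ℕ}

/-! ## Restriction of one factor to a set of values -/

section Restrict

/-- Restricting `φ_i` to the values in `Q` multiplies the product weight by `1[Q (v_i)]`. [folklore] -/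
theorem piWeight_update_restrict (φ : κ → ℕ → ℝ) (i : κ) (Q : ℕ → Prop) [DecidablePred Q] (v : κ → Fin (N + 1)) :
    piWeight N (update φ i (fun n => if Q n then φ i n else 0)) v = if Q (v i : ℕ) then piWeight N φ v else 0 := by
  rw [piWeight_eq_mul_erase _ i, piWeight_eq_mul_erase φ i, update_self]
  have : ∏ j ∈ univ.erase i, update φ i (fun n => if Q n then φ i n else 0) j (v j) = ∏ j ∈ univ.erase i, φ j (v j) :=
    prod_congr rfl fun j hj => by rw [update_of_ne (ne_of_mem_erase hj)]
  rw [this]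
  split_ifs <;> simp

omit [Fintype κ] in
/-- Restricting `φ_i` below `c` keeps the factors `PF₂`. [cite: Karlin1968, Ch. 8 §1] -/
theorem isLogConcaveSeq_update_truncLT {φ : κ → ℕ → ℝ} (hφ : ∀ j, IsLogConcaveSeq (φ j)) (i : κ) (c : ℕ) (j : κ) :
    IsLogConcaveSeq (update φ i (fun n => if n < c then φ i n else 0) j) := by
  by_cases hj : j = i
  · subst hj; rw [update_self]; exact (hφ j).truncLT c
  · rw [update_of_ne hj]; exact hφ j

omit [Fintype κ] [DecidableEq κ] in
/-- The restricted numerator `u·1[Q (v_i)]` is nonnegative. [folklore] -/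
theorem restrict_nonneg {u : (κ → Fin (N + 1)) → ℝ} (hu0 : ∀ v, 0 ≤ u v) (i : κ) (Q : ℕ → Prop) [DecidablePred Q]
    (v : κ → Fin (N + 1)) : 0 ≤ (if Q (v i : ℕ) then u v else 0) := by
  split_ifs <;> [exact hu0 v; exact le_rfl]

/-- The restricted numerator is dominated by the restricted weight. [folklore] -/
theorem restrict_le_piWeight (φ : κ → ℕ → ℝ) {u : (κ → Fin (N + 1)) → ℝ} (huΦ : ∀ v, u v ≤ piWeight N φ v) (i : κ)
    (Q : ℕ → Prop) [DecidablePred Q] (v : κ → Fin (N + 1)) :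
    (if Q (v i : ℕ) then u v else 0) ≤ piWeight N (update φ i (fun n => if Q n then φ i n else 0)) v := by
  rw [piWeight_update_restrict]
  split_ifs <;> [exact huΦ v; exact le_rfl]

omit [Fintype κ] in
/-- **The one-coordinate cross inequalities survive the restriction of one factor** (both sides pick up the same factor
`1[Q x]·1[Q x']`). [this work] -/
theorem restrict_cross {φ : κ → ℕ → ℝ} (hφ0 : ∀ j n, 0 ≤ φ j n) {u : (κ → Fin (N + 1)) → ℝ} (hu0 : ∀ v, 0 ≤ u v)
    (hmono : ∀ v j (x x' : Fin (N + 1)), x ≤ x' → u (update v j x) * φ j x' ≤ u (update v j x') * φ j x)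
    (i : κ) (Q : ℕ → Prop) [DecidablePred Q] (v : κ → Fin (N + 1)) (j : κ) (x x' : Fin (N + 1)) (hxx' : x ≤ x') :
    (if Q (update v j x i : ℕ) then u (update v j x) else 0) * update φ i (fun n => if Q n then φ i n else 0) j x' ≤
      (if Q (update v j x' i : ℕ) then u (update v j x') else 0) * update φ i (fun n => if Q n then φ i n else 0) j x := by
  have hnn : 0 ≤ (if Q (update v j x' i : ℕ) then u (update v j x') else 0) *
      update φ i (fun n => if Q n then φ i n else 0) j x := by
    refine mul_nonneg (by split_ifs <;> [exact hu0 _; exact le_rfl]) ?_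
    by_cases hj : j = i
    · subst hj; rw [update_self]; split_ifs <;> [exact hφ0 j _; exact le_rfl]
    · rw [update_of_ne hj]; exact hφ0 j _
  by_cases hj : j = i
  · subst hj
    simp only [update_self]
    by_cases hx : Q (x : ℕ)
    · by_cases hx' : Q (x' : ℕ)
      · rw [if_pos hx, if_pos hx', if_pos hx', if_pos hx]; exact hmono v j x x' hxx'
      · rw [if_neg hx', mul_zero, if_neg hx', zero_mul]
    · rw [if_neg hx, zero_mul]
      simp only [update_self] at hnn
      exact hnn
  · rw [update_of_ne (Ne.symm hj), update_of_ne (Ne.symm hj), update_of_ne hj]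
    by_cases hv : Q (v i : ℕ)
    · rw [if_pos hv, if_pos hv]; exact hmono v j x x' hxx'
    · rw [if_neg hv, zero_mul, if_neg hv, zero_mul]

end Restrict

/-! ## Universal `(2′)`-partners: the trivial event and single thresholds -/

section Base

/-- The trivial event `True` is a universal `(2′)`-partner (`K̃(Φ, u; Ω) = 0`). [this work] -/
theorem gridK_univ_true (B : (κ → Fin (N + 1)) → Prop) [DecidablePred B] (hB : ∀ v, B v) (φ : κ → ℕ → ℝ) (t : ℕ)
    (u : (κ → Fin (N + 1)) → ℝ) :
    0 ≤ (∑ v, piWeight N φ v) * (∑ v, if ¬ t ≤ blockSum univ v then piWeight N φ v else 0) * (∑ v, if t ≤ blockSum univ v ∧ B v then u v else 0)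
        + (∑ v, piWeight N φ v) * (∑ v, if ¬ t ≤ blockSum univ v then u v else 0) * (∑ v, if B v ∧ ¬ t ≤ blockSum univ v then piWeight N φ v else 0)
        - (∑ v, if ¬ t ≤ blockSum univ v then piWeight N φ v else 0) * (∑ v, u v) * (∑ v, if B v then piWeight N φ v else 0) := by
  rw [sum_ite_congr_prop u (P := fun v => t ≤ blockSum univ v ∧ B v) (Q := fun v => t ≤ blockSum univ v)
      (fun v => by simp [hB v]),
    sum_ite_congr_prop (piWeight N φ) (P := fun v => B v ∧ ¬ t ≤ blockSum univ v) (Q := fun v => ¬ t ≤ blockSum univ v)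
      (fun v => by simp [hB v]),
    show (∑ v, if B v then piWeight N φ v else 0) = ∑ v, piWeight N φ v from Fintype.sum_congr _ _ fun v => if_pos (hB v),
    sum_split u (fun v => t ≤ blockSum univ v)]
  apply le_of_eq; ring

/-- **A single coordinate threshold `{c ≤ v_i}` is a universal `(2′)`-partner** (gen 44's OR theorem with one threshold). [this work] -/
theorem gridK_univ_threshold (i : κ) (c : ℕ) (B : (κ → Fin (N + 1)) → Prop) [DecidablePred B] (hB : ∀ v, B v ↔ c ≤ (v i : ℕ))
    (φ : κ → ℕ → ℝ) (hφ : ∀ j, IsLogConcaveSeq (φ j)) (t : ℕ)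
    (u : (κ → Fin (N + 1)) → ℝ) (hu0 : ∀ v, 0 ≤ u v) (huΦ : ∀ v, u v ≤ piWeight N φ v)
    (hmono : ∀ v j (x x' : Fin (N + 1)), x ≤ x' → u (update v j x) * φ j x' ≤ u (update v j x') * φ j x) :
    0 ≤ (∑ v, piWeight N φ v) * (∑ v, if ¬ t ≤ blockSum univ v then piWeight N φ v else 0) * (∑ v, if t ≤ blockSum univ v ∧ B v then u v else 0)
        + (∑ v, piWeight N φ v) * (∑ v, if ¬ t ≤ blockSum univ v then u v else 0) * (∑ v, if B v ∧ ¬ t ≤ blockSum univ v then piWeight N φ v else 0)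
        - (∑ v, if ¬ t ≤ blockSum univ v then piWeight N φ v else 0) * (∑ v, u v) * (∑ v, if B v then piWeight N φ v else 0) := by
  have hiff : ∀ v : κ → Fin (N + 1), (∃ j, update (fun _ => N + 1) i c j ≤ (v j : ℕ)) ↔ B v := by
    intro v
    rw [hB v]
    constructor
    · rintro ⟨j, hj⟩
      by_cases hji : j = i
      · subst hji; rwa [update_self] at hj
      · rw [update_of_ne hji] at hj
        have := (v j).2; omega
    · intro hv; exact ⟨i, by rwa [update_self]⟩
  exact (gridK_or_nonneg φ hφ (update (fun _ => N + 1) i c) t u hu0 huΦ hmono).trans_eq (gridK_congr_prop t _ u hiff)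

end Base

/-! ## The two closure steps -/

section Steps

/-- **AND-STEP (chain rule).**  If `B` is increasing and a universal `(2′)`-partner, then so is `B₂ = {c ≤ v_i} ∩ B`. [this work] -/
theorem gridK_univ_andStep (i : κ) (c : ℕ) (B B₂ : (κ → Fin (N + 1)) → Prop) [DecidablePred B] [DecidablePred B₂]
    (hBmono : ∀ v v', v ≤ v' → B v → B v') (hB₂ : ∀ v, B₂ v ↔ c ≤ (v i : ℕ) ∧ B v)
    (hU : ∀ (φ : κ → ℕ → ℝ), (∀ j, IsLogConcaveSeq (φ j)) → ∀ (t : ℕ) (u : (κ → Fin (N + 1)) → ℝ), (∀ v, 0 ≤ u v) →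
      (∀ v, u v ≤ piWeight N φ v) →
      (∀ v j (x x' : Fin (N + 1)), x ≤ x' → u (update v j x) * φ j x' ≤ u (update v j x') * φ j x) →
      0 ≤ (∑ v, piWeight N φ v) * (∑ v, if ¬ t ≤ blockSum univ v then piWeight N φ v else 0) * (∑ v, if t ≤ blockSum univ v ∧ B v then u v else 0)
        + (∑ v, piWeight N φ v) * (∑ v, if ¬ t ≤ blockSum univ v then u v else 0) * (∑ v, if B v ∧ ¬ t ≤ blockSum univ v then piWeight N φ v else 0)
        - (∑ v, if ¬ t ≤ blockSum univ v then piWeight N φ v else 0) * (∑ v, u v) * (∑ v, if B v then piWeight N φ v else 0))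
    (φ : κ → ℕ → ℝ) (hφ : ∀ j, IsLogConcaveSeq (φ j)) (t : ℕ)
    (u : (κ → Fin (N + 1)) → ℝ) (hu0 : ∀ v, 0 ≤ u v) (huΦ : ∀ v, u v ≤ piWeight N φ v)
    (hmono : ∀ v j (x x' : Fin (N + 1)), x ≤ x' → u (update v j x) * φ j x' ≤ u (update v j x') * φ j x) :
    0 ≤ (∑ v, piWeight N φ v) * (∑ v, if ¬ t ≤ blockSum univ v then piWeight N φ v else 0) * (∑ v, if t ≤ blockSum univ v ∧ B₂ v then u v else 0)
        + (∑ v, piWeight N φ v) * (∑ v, if ¬ t ≤ blockSum univ v then u v else 0) * (∑ v, if B₂ v ∧ ¬ t ≤ blockSum univ v then piWeight N φ v else 0)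
        - (∑ v, if ¬ t ≤ blockSum univ v then piWeight N φ v else 0) * (∑ v, u v) * (∑ v, if B₂ v then piWeight N φ v else 0) := by
  have hφ0 : ∀ j n, 0 ≤ φ j n := fun j => (hφ j).1
  obtain ⟨a, ha, -, hua⟩ := exists_monotone_density hφ0 u hu0 huΦ hmono
  -- the restricted weights and numerator
  set φ' : κ → ℕ → ℝ := update φ i (fun n => if c ≤ n then φ i n else 0) with hφ'
  have hφ'lc : ∀ j, IsLogConcaveSeq (φ' j) := isLogConcaveSeq_update_truncGE hφ i c
  have hφ'0 : ∀ j n, 0 ≤ φ' j n := fun j => (hφ'lc j).1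
  have hw' : ∀ v, piWeight N φ' v = if c ≤ (v i : ℕ) then piWeight N φ v else 0 := piWeight_update_restrict φ i (fun n => c ≤ n)
  have hIH := hU φ' hφ'lc t (fun v => if c ≤ (v i : ℕ) then u v else 0) (restrict_nonneg hu0 i (fun n => c ≤ n))
    (restrict_le_piWeight φ huΦ i (fun n => c ≤ n)) (fun v j x x' hxx' => restrict_cross hφ0 hu0 hmono i (fun n => c ≤ n) v j x x' hxx')
  have hsingle := gridK_univ_threshold i c (fun v => c ≤ (v i : ℕ)) (fun v => Iff.rfl) φ hφ t u hu0 huΦ hmono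
  exact gridK_step hφ0 hφ'0 t ha hua hu0 huΦ (fun v => c ≤ (v i : ℕ)) B B₂
    (fun v v' h hv => hv.trans (by exact_mod_cast h i)) hBmono hB₂ hw' hsingle hIH

/-- **OR-STEP.**  If `B` does not depend on `v_i` and is a universal `(2′)`-partner, then so is `B₂ = {c ≤ v_i} ∪ B`. [this work] -/
theorem gridK_univ_orStep (i : κ) (c : ℕ) (B B₂ : (κ → Fin (N + 1)) → Prop) [DecidablePred B] [DecidablePred B₂]
    (hBi : ∀ v k, B (update v i k) ↔ B v) (hB₂ : ∀ v, B₂ v ↔ c ≤ (v i : ℕ) ∨ B v)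
    (hU : ∀ (φ : κ → ℕ → ℝ), (∀ j, IsLogConcaveSeq (φ j)) → ∀ (t : ℕ) (u : (κ → Fin (N + 1)) → ℝ), (∀ v, 0 ≤ u v) →
      (∀ v, u v ≤ piWeight N φ v) →
      (∀ v j (x x' : Fin (N + 1)), x ≤ x' → u (update v j x) * φ j x' ≤ u (update v j x') * φ j x) →
      0 ≤ (∑ v, piWeight N φ v) * (∑ v, if ¬ t ≤ blockSum univ v then piWeight N φ v else 0) * (∑ v, if t ≤ blockSum univ v ∧ B v then u v else 0)
        + (∑ v, piWeight N φ v) * (∑ v, if ¬ t ≤ blockSum univ v then u v else 0) * (∑ v, if B v ∧ ¬ t ≤ blockSum univ v then piWeight N φ v else 0)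
        - (∑ v, if ¬ t ≤ blockSum univ v then piWeight N φ v else 0) * (∑ v, u v) * (∑ v, if B v then piWeight N φ v else 0))
    (φ : κ → ℕ → ℝ) (hφ : ∀ j, IsLogConcaveSeq (φ j)) (t : ℕ)
    (u : (κ → Fin (N + 1)) → ℝ) (hu0 : ∀ v, 0 ≤ u v) (huΦ : ∀ v, u v ≤ piWeight N φ v)
    (hmono : ∀ v j (x x' : Fin (N + 1)), x ≤ x' → u (update v j x) * φ j x' ≤ u (update v j x') * φ j x) :
    0 ≤ (∑ v, piWeight N φ v) * (∑ v, if ¬ t ≤ blockSum univ v then piWeight N φ v else 0) * (∑ v, if t ≤ blockSum univ v ∧ B₂ v then u v else 0)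
        + (∑ v, piWeight N φ v) * (∑ v, if ¬ t ≤ blockSum univ v then u v else 0) * (∑ v, if B₂ v ∧ ¬ t ≤ blockSum univ v then piWeight N φ v else 0)
        - (∑ v, if ¬ t ≤ blockSum univ v then piWeight N φ v else 0) * (∑ v, u v) * (∑ v, if B₂ v then piWeight N φ v else 0) := by
  have hφ0 : ∀ j n, 0 ≤ φ j n := fun j => (hφ j).1
  have H0 := hU (update φ i (fun n => if n < c then φ i n else 0)) (isLogConcaveSeq_update_truncLT hφ i c) t
    (fun v => if (v i : ℕ) < c then u v else 0) (restrict_nonneg hu0 i (fun n => n < c))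
    (restrict_le_piWeight φ huΦ i (fun n => n < c))
    (fun v j x x' hxx' => restrict_cross hφ0 hu0 hmono i (fun n => n < c) v j x x' hxx')
  have H1 : ∀ x y : ℕ, x < c → c ≤ y → y ≤ N → _ := fun x y _ _ _ =>
    hU (update φ i (fun n => if n = y then φ i n else 0)) (isLogConcaveSeq_update_point hφ i y) (t + y - x)
      (fun v => if (v i : ℕ) = y then u v else 0) (restrict_nonneg hu0 i (fun n => n = y))
      (restrict_le_piWeight φ huΦ i (fun n => n = y))
      (fun v j x x' hxx' => restrict_cross hφ0 hu0 hmono i (fun n => n = y) v j x x' hxx')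
  exact (gridK_orStep φ hφ i c t B hBi u hu0 huΦ hmono H0 H1).trans_eq
    (gridK_congr_prop t _ u (B := fun v => c ≤ (v i : ℕ) ∨ B v) (B' := B₂) (fun v => (hB₂ v).symm))

end Steps

/-! ## THEOREM G45-B: caterpillar read-once formulas -/

section Caterpillar

omit [Fintype κ] [DecidableEq κ] in
/-- The event of a caterpillar formula is increasing. [this work] -/
theorem caterpillar_mono (L : List (κ × ℕ × Bool)) :
    ∀ v v' : κ → Fin (N + 1), v ≤ v' →
      L.foldr (fun e P => bif e.2.2 then (e.2.1 ≤ (v e.1 : ℕ) ∧ P) else (e.2.1 ≤ (v e.1 : ℕ) ∨ P)) True →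
      L.foldr (fun e P => bif e.2.2 then (e.2.1 ≤ (v' e.1 : ℕ) ∧ P) else (e.2.1 ≤ (v' e.1 : ℕ) ∨ P)) True := by
  induction L with
  | nil => intro v v' _ _; trivial
  | cons e L IH =>
    intro v v' h
    obtain ⟨i, c, b⟩ := e
    have hi : c ≤ (v i : ℕ) → c ≤ (v' i : ℕ) := fun hc => hc.trans (by exact_mod_cast h i)
    cases b
    · simp only [List.foldr_cons, cond_false]
      exact fun hv => hv.elim (fun hc => Or.inl (hi hc)) (fun hB => Or.inr (IH v v' h hB))
    · simp only [List.foldr_cons, cond_true]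
      exact fun hv => ⟨hi hv.1, IH v v' h hv.2⟩

omit [Fintype κ] in
/-- The event of a caterpillar formula does not depend on a coordinate that does not occur in it. [this work] -/
theorem caterpillar_update_iff (L : List (κ × ℕ × Bool)) (i : κ) (hi : ∀ e ∈ L, e.1 ≠ i) (v : κ → Fin (N + 1))
    (k : Fin (N + 1)) :
    L.foldr (fun e P => bif e.2.2 then (e.2.1 ≤ (update v i k e.1 : ℕ) ∧ P) else (e.2.1 ≤ (update v i k e.1 : ℕ) ∨ P)) True ↔
      L.foldr (fun e P => bif e.2.2 then (e.2.1 ≤ (v e.1 : ℕ) ∧ P) else (e.2.1 ≤ (v e.1 : ℕ) ∨ P)) True := by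
  induction L with
  | nil => exact Iff.rfl
  | cons e L IH =>
    obtain ⟨j, c, b⟩ := e
    have hj : j ≠ i := hi _ (List.mem_cons_self ..)
    have IH' := IH (fun e he => hi e (List.mem_cons_of_mem _ he))
    cases b
    · simp only [List.foldr_cons, cond_false, update_of_ne hj]
      rw [IH']
    · simp only [List.foldr_cons, cond_true, update_of_ne hj]
      rw [IH']

/-- **THEOREM G45-B (homogeneous form).**  On a finite product of `PF₂` chains with the Hamming slot, every caterpillar read-once
formula of coordinate thresholds — a list of nodes `(i, c, tag)` read from the outside in, `tag = true` an AND-node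
`{c ≤ v_i} ∩ (inner formula)`, `tag = false` an OR-node `{c ≤ v_i} ∪ (inner formula)` whose coordinate `i` does not occur further
inside, innermost formula `True` — is a universal `(2′)`-partner: `K̃(Φ, u; B) ≥ 0` for all `PF₂` weights, all slots and all
numerators with the cross inequalities. [this work] -/
theorem gridK_caterpillar_nonneg (L : List (κ × ℕ × Bool)) (hL : L.Pairwise (fun e e' => e.2.2 = false → e.1 ≠ e'.1)) :
    ∀ (φ : κ → ℕ → ℝ), (∀ j, IsLogConcaveSeq (φ j)) → ∀ (t : ℕ) (u : (κ → Fin (N + 1)) → ℝ), (∀ v, 0 ≤ u v) →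
      (∀ v, u v ≤ piWeight N φ v) →
      (∀ v j (x x' : Fin (N + 1)), x ≤ x' → u (update v j x) * φ j x' ≤ u (update v j x') * φ j x) →
      0 ≤ (∑ v, piWeight N φ v) * (∑ v, if ¬ t ≤ blockSum univ v then piWeight N φ v else 0) *
            (∑ v, if t ≤ blockSum univ v ∧
              L.foldr (fun e P => bif e.2.2 then (e.2.1 ≤ (v e.1 : ℕ) ∧ P) else (e.2.1 ≤ (v e.1 : ℕ) ∨ P)) True then u v else 0)
        + (∑ v, piWeight N φ v) * (∑ v, if ¬ t ≤ blockSum univ v then u v else 0) *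
            (∑ v, if L.foldr (fun e P => bif e.2.2 then (e.2.1 ≤ (v e.1 : ℕ) ∧ P) else (e.2.1 ≤ (v e.1 : ℕ) ∨ P)) True ∧
              ¬ t ≤ blockSum univ v then piWeight N φ v else 0)
        - (∑ v, if ¬ t ≤ blockSum univ v then piWeight N φ v else 0) * (∑ v, u v) *
            (∑ v, if L.foldr (fun e P => bif e.2.2 then (e.2.1 ≤ (v e.1 : ℕ) ∧ P) else (e.2.1 ≤ (v e.1 : ℕ) ∨ P)) True
              then piWeight N φ v else 0) := by
  induction L with
  | nil =>
    intro φ _ t u _ _ _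
    exact gridK_univ_true (fun v : κ → Fin (N + 1) => List.foldr
      (fun (e : κ × ℕ × Bool) P => bif e.2.2 then (e.2.1 ≤ (v e.1 : ℕ) ∧ P) else (e.2.1 ≤ (v e.1 : ℕ) ∨ P)) True [])
      (fun v => trivial) φ t u
  | cons e L IH =>
    intro φ hφ t u hu0 huΦ hmono
    rw [List.pairwise_cons] at hL
    have IH' := IH hL.2
    obtain ⟨i, c, b⟩ := e
    cases b
    · -- OR-node
      have hi : ∀ e' ∈ L, e'.1 ≠ i := fun e' he' => (hL.1 e' he' rfl).symm
      exact gridK_univ_orStep i c _ _ (fun v k => caterpillar_update_iff L i hi v k)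
        (fun v => by simp only [List.foldr_cons, cond_false]) IH' φ hφ t u hu0 huΦ hmono
    · -- AND-node
      exact gridK_univ_andStep i c _ _ (caterpillar_mono L)
        (fun v => by simp only [List.foldr_cons, cond_true]) IH' φ hφ t u hu0 huΦ hmono

/-- **THEOREM G45-B, five-term shape of `osN_ind_ind`** (normalised weights), ready for the cube: `(2′)` on a product of `PF₂`
chains for every monotone density against every caterpillar read-once formula of coordinate thresholds. [this work] -/
theorem grid_osN_caterpillar_nonneg (L : List (κ × ℕ × Bool)) (hL : L.Pairwise (fun e e' => e.2.2 = false → e.1 ≠ e'.1))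
    (φ : κ → ℕ → ℝ) (hφ : ∀ j, IsLogConcaveSeq (φ j)) (hφ1 : ∀ j, ∑ n : Fin (N + 1), φ j n = 1)
    (t : ℕ) (u : (κ → Fin (N + 1)) → ℝ) (hu0 : ∀ v, 0 ≤ u v) (huΦ : ∀ v, u v ≤ piWeight N φ v)
    (hmono : ∀ v j (x x' : Fin (N + 1)), x ≤ x' → u (update v j x) * φ j x' ≤ u (update v j x') * φ j x) :
    0 ≤ (∑ v : κ → Fin (N + 1), if t ≤ blockSum univ v then u v else 0) *
          (∑ v : κ → Fin (N + 1), if t ≤ blockSum univ v ∧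
            L.foldr (fun e P => bif e.2.2 then (e.2.1 ≤ (v e.1 : ℕ) ∧ P) else (e.2.1 ≤ (v e.1 : ℕ) ∨ P)) True
            then piWeight N φ v else 0)
      + (1 - ∑ v : κ → Fin (N + 1), if t ≤ blockSum univ v then piWeight N φ v else 0) *
          (∑ v : κ → Fin (N + 1), if t ≤ blockSum univ v ∧
            L.foldr (fun e P => bif e.2.2 then (e.2.1 ≤ (v e.1 : ℕ) ∧ P) else (e.2.1 ≤ (v e.1 : ℕ) ∨ P)) True
            then u v else 0)
      + (∑ v : κ → Fin (N + 1), if t ≤ blockSum univ v then piWeight N φ v else 0) * (∑ v : κ → Fin (N + 1), u v) *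
          (∑ v : κ → Fin (N + 1), if
            L.foldr (fun e P => bif e.2.2 then (e.2.1 ≤ (v e.1 : ℕ) ∧ P) else (e.2.1 ≤ (v e.1 : ℕ) ∨ P)) True
            then piWeight N φ v else 0)
      - (∑ v : κ → Fin (N + 1), if t ≤ blockSum univ v then u v else 0) *
          (∑ v : κ → Fin (N + 1), if
            L.foldr (fun e P => bif e.2.2 then (e.2.1 ≤ (v e.1 : ℕ) ∧ P) else (e.2.1 ≤ (v e.1 : ℕ) ∨ P)) True
            then piWeight N φ v else 0)
      - (∑ v : κ → Fin (N + 1), if t ≤ blockSum univ v ∧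
            L.foldr (fun e P => bif e.2.2 then (e.2.1 ≤ (v e.1 : ℕ) ∧ P) else (e.2.1 ≤ (v e.1 : ℕ) ∨ P)) True
            then piWeight N φ v else 0) * (∑ v : κ → Fin (N + 1), u v) := by
  have hsum1 : ∑ v, piWeight N φ v = 1 := by
    rw [sum_piWeight_eq_prod, prod_congr rfl fun j _ => hφ1 j]; simp
  have h := gridK_caterpillar_nonneg L hL φ hφ t u hu0 huΦ hmono
  rw [← fiveTerm_eq_gridK t (piWeight N φ) u (fun v => L.foldr
    (fun e P => bif e.2.2 then (e.2.1 ≤ (v e.1 : ℕ) ∧ P) else (e.2.1 ≤ (v e.1 : ℕ) ∨ P)) True) hsum1] at h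
  exact h

end Caterpillar

end ProfileGrid

end SahiOneStep

end Summit.CriticalPhenomena.PercolationContinuityZ3.Theorems
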